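import Literature.AlgebraicGeometry.Motives.AbelianVarietyQuotientFlat
import HarnessLib

/-!
# The quotient `P/S`: fibres of `h` on field-valued points

Continuation of `AbelianVarietyQuotientFlat` (notation: `Y = P_L`, `G = S ⋊ Aut(L/K)` acting
freely on `Y` over `P`, `P/S = Y/G`, `π : Y → P/S`, `h : P → P/S` flat, surjective,
quasi-compact, with `pr ≫ h = π`). Towards the descent of the group law of `P` to `P/S`
(Mumford, *Abelian Varieties*, §7 Thm. 4 p. 72, §12), this file proves the pointwise input:

* generalities: `φ ⊗ ψ`, `X ◁ ψ`, `ψ ▷ X` inherit flatness/surjectivity/quasi-compactness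
  (`tensorHom_left_mem`, …) and are then epimorphisms of `K`-schemes (`epi_tensorHom`, …);
  `exists_lstructure`: a field-valued point of `Spec K` acquires an `L`-structure after a field
  extension (a residue field of `Ω ⊗_K L`);
* `transl_fst_quotientMap`, `constPt_mul_fstPt_comp_quotientMapOver`: `h` is invariant under
  translation by `S` (`h (s · w) = h w` on `T`-points factoring through `Y`);
* `exists_eq_point_mul` (**orbit lemma**): two `Ω`-points of `P` (`Ω ⊇ L`) with the same image
  under `h` differ by translation by some `s ∈ S`
  (`ActionOver.exists_eq_comp_aut_of_comp_toQuotient_eq`);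
* `mul_comp_quotientMapOver_eq`: `h(a · b₁) = h(a · b₂)` whenever `h b₁ = h b₂`, for field-valued
  points — the pointwise form of the descent of the group law.

## References

* [MumfordAV1970] D. Mumford, *Abelian Varieties*, §7 Thm. 4 (p. 72), §12.
* [Kieffer2024IsogenyGraphs] J. Kieffer, Prop. 1.1.10 (p. 10).
-/

universe u

open CategoryTheory CategoryTheory.Limits AlgebraicGeometry

namespace Literature.AlgebraicGeometry.Motives

namespace AbelianVariety

open scoped MonObj Obj
open Literature.AlgebraicGeometry.RelativeSpec Literature.AlgebraicGeometry.Morphisms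
open MonoidalCategory CartesianMonoidalCategory TensorProduct

variable {K : Type u} [Field K] (L : Type u) [Field L] [Algebra K L] (P : AbelianVariety K)
variable (S : Subgroup (P.Points L))
  (hS : ∀ (σ : L ≃ₐ[K] L) (s : P.Points L), s ∈ S → σ • s ∈ S)
  (q : P ⟶ P) (hSq : ∀ s ∈ S, s ≫ q.hom.hom.hom = 1)

/-! ### Generalities: products of fpqc covers of `K`-schemes -/

/-- A property of scheme morphisms stable under base change and composition passes from the
underlying morphisms of `φ`, `ψ` to that of `φ ⊗ ψ = φ ×_K ψ` (Mathlib `Over.tensorHom_left`,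
`MorphismProperty.pullbackMap`). [folklore] -/
theorem tensorHom_left_mem (W : MorphismProperty Scheme.{u}) [W.IsStableUnderBaseChange]
    [W.IsStableUnderComposition] {X Y X' Y' : SchemeOver K} (φ : X ⟶ Y) (ψ : X' ⟶ Y')
    (hφ : W φ.left) (hψ : W ψ.left) : W (φ ⊗ₘ ψ).left := by
  rw [Over.tensorHom_left]
  exact MorphismProperty.pullbackMap hφ hψ (Over.w φ).symm (Over.w ψ).symm

/-- The same for `X ◁ ψ = X ×_K ψ`. [folklore] -/
theorem whiskerLeft_left_mem (W : MorphismProperty Scheme.{u}) [W.IsStableUnderBaseChange]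
    [W.IsStableUnderComposition] [W.ContainsIdentities] {X Y Y' : SchemeOver K} (ψ : Y ⟶ Y')
    (hψ : W ψ.left) : W (X ◁ ψ).left := by
  rw [Over.whiskerLeft_left]
  exact MorphismProperty.pullbackMap (W.id_mem _) hψ (Category.id_comp _).symm (Over.w ψ).symm

/-- The same for `ψ ▷ X = ψ ×_K X`. [folklore] -/
theorem whiskerRight_left_mem (W : MorphismProperty Scheme.{u}) [W.IsStableUnderBaseChange]
    [W.IsStableUnderComposition] [W.ContainsIdentities] {X Y Y' : SchemeOver K} (ψ : Y ⟶ Y')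
    (hψ : W ψ.left) : W (ψ ▷ X).left := by
  rw [Over.whiskerRight_left]
  exact MorphismProperty.pullbackMap hψ (W.id_mem _) (Over.w ψ).symm (Category.id_comp _).symm

/-- A morphism of `K`-schemes whose underlying morphism is flat and surjective is an
epimorphism (Mathlib `Flat.epi_of_flat_of_surjective`, `Over.epi_of_epi_left`). [folklore] -/
theorem epi_of_flat_left {X Y : SchemeOver K} (φ : X ⟶ Y) [Flat φ.left] [Surjective φ.left] :
    Epi φ :=
  haveI := Flat.epi_of_flat_of_surjective φ.left
  Over.epi_of_epi_left φ

/-- `φ ⊗ ψ` is an epimorphism of `K`-schemes when `φ`, `ψ` are flat and surjective. [folklore] -/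
theorem epi_tensorHom {X Y X' Y' : SchemeOver K} (φ : X ⟶ Y) (ψ : X' ⟶ Y')
    [Flat φ.left] [Surjective φ.left] [Flat ψ.left] [Surjective ψ.left] : Epi (φ ⊗ₘ ψ) :=
  haveI : Flat (φ ⊗ₘ ψ).left := tensorHom_left_mem @Flat φ ψ ‹_› ‹_›
  haveI : Surjective (φ ⊗ₘ ψ).left := tensorHom_left_mem @Surjective φ ψ ‹_› ‹_›
  epi_of_flat_left _

/-- `X ◁ ψ` is an epimorphism of `K`-schemes when `ψ` is flat and surjective. [folklore] -/
theorem epi_whiskerLeft {X Y Y' : SchemeOver K} (ψ : Y ⟶ Y') [Flat ψ.left] [Surjective ψ.left] :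
    Epi (X ◁ ψ) :=
  haveI : Flat (X ◁ ψ).left := whiskerLeft_left_mem @Flat ψ ‹_›
  haveI : Surjective (X ◁ ψ).left := whiskerLeft_left_mem @Surjective ψ ‹_›
  epi_of_flat_left _

/-- `ψ ▷ X` is an epimorphism of `K`-schemes when `ψ` is flat and surjective. [folklore] -/
theorem epi_whiskerRight {X Y Y' : SchemeOver K} (ψ : Y ⟶ Y') [Flat ψ.left] [Surjective ψ.left] :
    Epi (ψ ▷ X) :=
  haveI : Flat (ψ ▷ X).left := whiskerRight_left_mem @Flat ψ ‹_›
  haveI : Surjective (ψ ▷ X).left := whiskerRight_left_mem @Surjective ψ ‹_›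
  epi_of_flat_left _

/-! ### An `L`-structure on a field-valued point, after a field extension -/

/-- For a field `Ω` over `K` there is a field extension `Ω'/Ω` with a `K`-embedding `L → Ω'`
(a residue field of `Ω ⊗_K L`); `Spec Ω' → Spec Ω` is an epimorphism. [folklore] -/
theorem exists_lstructure {Ω : Type u} [Field Ω] (κ : Spec (.of Ω) ⟶ Spec (.of K)) :
    ∃ (Ω' : Type u) (_ : Field Ω') (e : Spec (.of Ω') ⟶ Spec (.of Ω))
      (lam : Spec (.of Ω') ⟶ Spec (.of L)), Epi e ∧ lam ≫ bcSpec K L = e ≫ κ := by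
  obtain ⟨φ, rfl⟩ : ∃ φ : CommRingCat.of K ⟶ .of Ω, Spec.map φ = κ := ⟨_, Spec.map_preimage κ⟩
  letI : Algebra K Ω := φ.hom.toAlgebra
  haveI : Nontrivial (Ω ⊗[K] L) :=
    (Algebra.TensorProduct.includeRight_injective (R := K) (A := Ω) (B := L)
      (algebraMap K Ω).injective).nontrivial
  obtain ⟨m, hm⟩ := Ideal.exists_maximal (Ω ⊗[K] L)
  letI : Field ((Ω ⊗[K] L) ⧸ m) := Ideal.Quotient.field m
  refine ⟨(Ω ⊗[K] L) ⧸ m, inferInstance,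
    Spec.map (CommRingCat.ofHom (algebraMap Ω ((Ω ⊗[K] L) ⧸ m))),
    Spec.map (CommRingCat.ofHom ((Ideal.Quotient.mk m).comp
      (Algebra.TensorProduct.includeRight (R := K) (A := Ω) (B := L)).toRingHom)),
    epi_of_hom_spec_field _, ?_⟩
  change Spec.map _ ≫ Spec.map _ = Spec.map _ ≫ Spec.map φ
  rw [← Spec.map_comp, ← Spec.map_comp]
  congr 1
  ext x
  change Ideal.Quotient.mk m (Algebra.TensorProduct.includeRight (R := K) (A := Ω) (B := L)
    (algebraMap K L x)) = algebraMap Ω ((Ω ⊗[K] L) ⧸ m) (algebraMap K Ω x)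
  rw [AlgHom.commutes, ← Ideal.Quotient.mk_algebraMap, ← IsScalarTower.algebraMap_apply]

section Quotient

variable [FiniteDimensional K L] [IsGalois K L] [Finite S] [IsAffineHom (Hom.toSchemeHom q)]

/-! ### `h` and its products are epimorphisms -/

/-- `h` is flat (instance form of `flat_quotientMap`). [folklore] -/
instance flat_quotientMapOver_left : Flat (P.quotientMapOver L S hS q hSq).left :=
  P.flat_quotientMap L S hS q hSq

/-- `h` is surjective (instance form of `surjective_quotientMap`). [folklore] -/
instance surjective_quotientMapOver_left : Surjective (P.quotientMapOver L S hS q hSq).left :=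
  P.surjective_quotientMap L S hS q hSq

/-- `h` is quasi-compact (instance form). [folklore] -/
instance quasiCompact_quotientMapOver_left : QuasiCompact (P.quotientMapOver L S hS q hSq).left :=
  P.quasiCompact_quotientMap L S hS q hSq

/-- `h` is an epimorphism of `K`-schemes. [folklore] -/
instance epi_quotientMapOver : Epi (P.quotientMapOver L S hS q hSq) := epi_of_flat_left _

/-! ### Translation invariance of `h` -/

/-- **`h` is invariant under translation by `S`**: `t_s ≫ pr ≫ h = pr ≫ h` on `Y = P_L`
(`pr ≫ h = π` and `π` is `G`-invariant). [folklore] -/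
theorem transl_fst_quotientMap (s : S) :
    P.transl L s ≫ pullback.fst P.X.hom (bcSpec K L) ≫ P.quotientMap L S hS q hSq =
      pullback.fst P.X.hom (bcSpec K L) ≫ P.quotientMap L S hS q hSq := by
  have h := (P.quotAction L S hS q hSq).aut_hom_toQuotient (SemidirectProduct.inl s)
  rw [quotAction_aut_hom, SemidirectProduct.right_inl, SemidirectProduct.left_inl, gal_one,
    Category.id_comp] at h
  rw [fst_quotientMap]
  exact h

/-- Translation invariance on `T`-points: for a `K`-morphism `V : T → Y` and `s ∈ S`,
`h ∘ ((s ∘ pr₂ ∘ V) · (pr ∘ V)) = h ∘ (pr ∘ V)` in `(P/S)(T)`. [folklore] -/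
theorem constPt_mul_fstPt_comp_quotientMapOver {T : SchemeOver K} (V : T ⟶ P.bcOverK L) (s : S) :
    ((V ≫ P.constPt L s) * (V ≫ P.fstPt L)) ≫ P.quotientMapOver L S hS q hSq =
      (V ≫ P.fstPt L) ≫ P.quotientMapOver L S hS q hSq := by
  rw [← MonObj.comp_mul, Category.assoc, Category.assoc]
  congr 1
  ext
  change (P.constPt L (s : P.Points L) * P.fstPt L).left ≫ P.quotientMap L S hS q hSq =
    pullback.fst P.X.hom (bcSpec K L) ≫ P.quotientMap L S hS q hSq
  rw [← transl_fst]
  exact (Category.assoc _ _ _).trans (P.transl_fst_quotientMap L S hS q hSq s)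

/-! ### The fibres of `h` on field-valued points are the `S`-orbits -/

/-- **Orbit lemma for `h` on `Ω`-points with an `L`-structure.** If two `Ω`-points `B₁, B₂` of
`P` over `K`, where `Ω` is given an `L`-structure `λ`, have the same image under `h`, then
`B₂ = s(λ) · B₁` for some `s ∈ S` (from `ActionOver.exists_eq_comp_aut_of_comp_toQuotient_eq`:
the lifts `(Bᵢ, λ)` of the two points to `Y = P_L` have the same image under `π`, hence differ
by an element `(s, σ)` of `G = S ⋊ Aut(L/K)`, and `pr ∘ (s, σ) = (σ⁻¹s ∘ λ) · pr`).
[cite: MumfordAV1970, §7 Thm. 4 p. 72] -/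
theorem exists_eq_point_mul {Ω : Type u} [Field Ω] (κ : Spec (.of Ω) ⟶ Spec (.of K))
    (lam : Spec (.of Ω) ⟶ Spec (.of L)) (hlam : lam ≫ bcSpec K L = κ)
    (B₁ B₂ : Over.mk κ ⟶ P.X)
    (h₁₂ : B₁ ≫ P.quotientMapOver L S hS q hSq = B₂ ≫ P.quotientMapOver L S hS q hSq) :
    ∃ s : S, B₂ = ((Over.homMk lam hlam : Over.mk κ ⟶ specOver K L) ≫ (s : P.Points L)) * B₁ := by
  have hw : ∀ B : Over.mk κ ⟶ P.X, B.left ≫ P.X.hom = lam ≫ bcSpec K L := fun B ↦ by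
    rw [hlam]; exact Over.w B
  let b₁ : Spec (.of Ω) ⟶ P.bcLeft L := pullback.lift B₁.left lam (hw B₁)
  let b₂ : Spec (.of Ω) ⟶ P.bcLeft L := pullback.lift B₂.left lam (hw B₂)
  have hπ : b₁ ≫ (P.quotAction L S hS q hSq).toQuotient =
      b₂ ≫ (P.quotAction L S hS q hSq).toQuotient := by
    rw [← fst_quotientMap, pullback.lift_fst_assoc, pullback.lift_fst_assoc]
    exact congrArg CommaMorphism.left h₁₂
  obtain ⟨g, hg⟩ := (P.quotAction L S hS q hSq).exists_eq_comp_aut_of_comp_toQuotient_eq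
    (fun U g hg ↦ P.quotAction_free L S hS q hSq U g hg) b₁ b₂ hπ
  have hV : (b₁ ≫ P.gal L g.right) ≫ pullback.snd P.X.hom (bcSpec K L) ≫ bcSpec K L = κ := by
    rw [Category.assoc, gal_snd_assoc, pullback.lift_snd_assoc, ← hlam]
    congr 1
    exact Over.w (AlgPoints.specMap (k := K) g.right⁻¹)
  let V : Over.mk κ ⟶ P.bcOverK L := Over.homMk (b₁ ≫ P.gal L g.right) hV
  have h1 : V ≫ P.fstPt L = B₁ := by
    ext
    change (b₁ ≫ P.gal L g.right) ≫ pullback.fst P.X.hom (bcSpec K L) = B₁.left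
    rw [Category.assoc, gal_fst, pullback.lift_fst]
  have h2 : V ≫ P.constPt L g.left =
      (Over.homMk lam hlam : Over.mk κ ⟶ specOver K L) ≫ (g.right⁻¹ • (g.left : P.Points L)) := by
    ext
    change (b₁ ≫ P.gal L g.right) ≫ pullback.snd P.X.hom (bcSpec K L) ≫ (g.left : P.Points L).left =
      lam ≫ (g.right⁻¹ • (g.left : P.Points L)).left
    rw [Category.assoc, gal_snd_assoc, pullback.lift_snd_assoc, AlgPoints.smul_left]
  refine ⟨⟨g.right⁻¹ • (g.left : P.Points L), hS _ _ g.left.2⟩, ?_⟩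
  change B₂ = ((Over.homMk lam hlam : Over.mk κ ⟶ specOver K L) ≫
    (g.right⁻¹ • (g.left : P.Points L))) * B₁
  rw [← h2, ← h1, ← MonObj.comp_mul]
  ext
  change B₂.left = (b₁ ≫ P.gal L g.right) ≫ (P.constPt L (g.left : P.Points L) * P.fstPt L).left
  rw [← transl_fst, Category.assoc, ← Category.assoc (P.gal L g.right),
    ← P.quotAction_aut_hom L S hS q hSq g, ← Category.assoc, ← hg]
  exact (pullback.lift_fst _ _ _).symm

/-- **`h(a · b₁) = h(a · b₂)` whenever `h(b₁) = h(b₂)`**, for field-valued points `a, b₁, b₂`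
of `P` over `K`: after a field extension giving an `L`-structure (an epimorphism on `Spec`),
`b₂ = c · b₁` with `c = s ∘ λ` (`exists_eq_point_mul`), so `a · b₂ = c · (a · b₁)`
(commutativity of `P(T)`), and `h (c · w) = h w` (`constPt_mul_fstPt_comp_quotientMapOver`).
This is the pointwise form of "the group law of `P` descends to `P/S`"
(Mumford, *Abelian Varieties*, §7, Thm. 4; §12). [cite: MumfordAV1970, §7 Thm. 4 p. 72] -/
theorem mul_comp_quotientMapOver_eq {Ω : Type u} [Field Ω] (κ : Spec (.of Ω) ⟶ Spec (.of K))
    (A B₁ B₂ : Over.mk κ ⟶ P.X)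
    (h₁₂ : B₁ ≫ P.quotientMapOver L S hS q hSq = B₂ ≫ P.quotientMapOver L S hS q hSq) :
    (A * B₁) ≫ P.quotientMapOver L S hS q hSq = (A * B₂) ≫ P.quotientMapOver L S hS q hSq := by
  -- reduce to the case where `Ω` has an `L`-structure
  suffices key : ∀ {Ω' : Type u} [Field Ω'] (κ' : Spec (.of Ω') ⟶ Spec (.of K))
      (lam : Spec (.of Ω') ⟶ Spec (.of L)) (_ : lam ≫ bcSpec K L = κ')
      (A' B₁' B₂' : Over.mk κ' ⟶ P.X)
      (_ : B₁' ≫ P.quotientMapOver L S hS q hSq = B₂' ≫ P.quotientMapOver L S hS q hSq),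
      (A' * B₁') ≫ P.quotientMapOver L S hS q hSq =
        (A' * B₂') ≫ P.quotientMapOver L S hS q hSq by
    obtain ⟨Ω', _, e, lam, he, hlam⟩ := exists_lstructure L κ
    let eO : Over.mk (e ≫ κ) ⟶ Over.mk κ := Over.homMk e rfl
    haveI : Epi eO.left := he
    haveI : Epi eO := Over.epi_of_epi_left _
    rw [← cancel_epi eO, ← Category.assoc, ← Category.assoc, MonObj.comp_mul, MonObj.comp_mul]
    exact key (e ≫ κ) lam hlam (eO ≫ A) (eO ≫ B₁) (eO ≫ B₂)
      (by rw [Category.assoc, Category.assoc, h₁₂])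
  intro Ω' _ κ' lam hlam A' B₁' B₂' h'
  obtain ⟨s, hB⟩ := P.exists_eq_point_mul L S hS q hSq κ' lam hlam B₁' B₂' h'
  rw [hB, mul_left_comm]
  set W := A' * B₁' with hW
  have hw : W.left ≫ P.X.hom = lam ≫ bcSpec K L := by
    rw [hlam]
    exact Over.w W
  let V' : Over.mk κ' ⟶ P.bcOverK L :=
    Over.homMk (pullback.lift W.left lam hw) (by
      change pullback.lift _ _ _ ≫ pullback.snd P.X.hom (bcSpec K L) ≫ bcSpec K L = κ'
      rw [pullback.lift_snd_assoc, hlam])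
  have h1 : V' ≫ P.fstPt L = W := by
    ext
    exact pullback.lift_fst _ _ _
  have h2 : V' ≫ P.constPt L s = (Over.homMk lam hlam : Over.mk κ' ⟶ specOver K L) ≫ (s : P.Points L) := by
    ext
    change pullback.lift _ _ _ ≫ pullback.snd P.X.hom (bcSpec K L) ≫ (s : P.Points L).left =
      lam ≫ (s : P.Points L).left
    rw [pullback.lift_snd_assoc]
  rw [← h1, ← h2]
  exact (P.constPt_mul_fstPt_comp_quotientMapOver L S hS q hSq V' s).symm

end Quotient

end AbelianVariety

end Literature.AlgebraicGeometry.Motives
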